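import Summits.BirchSwinnertonDyer.BirchSwinnertonDyer.Theorems.AlignedTransportAtTwoMainConjectureOfRankZeroBSDAtTwoCubicDoorsDeadSubcellClassNumberE
import Summits.BirchSwinnertonDyer.Rank1Residual.X5.TwoAdicInstancesToolkitB
import Literature.NumberTheory.CubicFields.CubicFieldDiscriminant13971ClassNumber
import HarnessLib

/-!
# Route `AlignedTransportAtTwo`, crux C2 `MainConjectureOfRankZeroBSDAtTwo` (stmt-BirchSwinnertonDyer-22298):
# CLASS NUMBER ONE V (J) — the u7 sub-cell: `h(ℚ(β)) = 1` IN THE KERNEL for `[1, 1, 0, -122, -573]` (`N = 13971`), an UNTYPED seed of g38's census (no monogenic `θ` in g38's box)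

HONEST FRAMING (cell `bsd-f1-sign2`, WIDTH-5 attached prover seat `bsd-line-att-p4` gen 39 on line `birth` of the lead `bsd-line-att-p2`;
`--supports` stmt-BirchSwinnertonDyer-22298, closes nothing; BSD is NOT proved by any of this; the crux C2, its verdict «blocked-on
`Rank1Residual.GreenbergMuConjectureIrreducible`» and every registered stub are untouched).  THEOREMS ONLY (no `def`, no named fact, no instance, no `sorry`);
the curve is written LITERALLY; no Cremona label is asserted (names use `n<conductor>`).

WHAT.  Same template as att-p4 g38's `…CubicDoorsDeadSubcellClassNumber{A..H}` for the rank-`0` u7 seed `[1, 1, 0, -122, -573]` of conductor `13971` (13971),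
which g38 could not type («no monogenic θ in range»).  This seat found the monogenic generator by LLL on the `2`-saturated integral basis of `ℤ[u]` (`u = 4β`):
`θ = −5g² + (111/4)g + 841/2 = (6728 + 111u − 5u²)/16` is a root of `f = X³ + X² + 15X + 12` of (squarefree) discriminant `−13971`, so `ℚ(β)` is the cubic field of discriminant `−13971` (LMFDB 3.1.13971.1),
whose class number is ONE by this seat's `Literature.NumberTheory.CubicFields.CubicDisc13971.classNumber_eq_one`.  Per curve: `Δ`, `c₄`, ellipticity, global
minimality, `#Ẽ(𝔽₂) = 2` (good ORDINARY at `2`), `b₂,b₄,b₆`, `E[2]` irreducible, `Δ_min ≡ 5 (mod 8)` (off the Kilford stratum), `Δ < 0`, ★ `aeval_theta_n13971`,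
`finrank`, `discr`, ★ `classNumber_cubicField_n13971_eq_one`, ★ `not_two_dvd_classNumber_cubicField_n13971`.  Census (seat memo `Cruxes/…/DEPTH-DOOR-CUSTOMERS-att-p4-g39.md`):
layer-two territory: unit class `±1 (mod 16)` (`t = 4`), genus regime (α), `e₁ ≥ 2`.  Nothing is asserted about `μ₂` or `MC₂` here.

References: [LMFDB] number field 3.1.13971.1, elliptic curve of conductor 13971; [Marcus2018] Ch. 5 Thm. 37; [SilvermanAEC2009] III.1, III.2.3, VII.1, VII.5; [Serre1973] II §3.3;
tree: att-p4 g38 `…CubicDoorsDeadSubcellClassNumberE` (template), `Literature/NumberTheory/CubicFields/CubicFieldDiscriminant13971ClassNumber`.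
-/

set_option linter.dupNamespace false
set_option autoImplicit false

noncomputable section

open scoped Classical NumberField nonZeroDivisors IntermediateField

namespace Summit.BirchSwinnertonDyer.BirchSwinnertonDyer.Theorems.AlignedTransportAtTwoCubicDoorsDeadSubcellClassNumberJ

open NumberField IsDedekindDomain Polynomial WeierstrassCurve IntermediateField CongruenceSubgroup Module
  Literature.NumberTheory.IwasawaTheory Literature.NumberTheory.GaloisRepresentations
  Literature.NumberTheory.EllipticCurves Literature.NumberTheory.EllipticCurves.Greenberg1999
  Literature.NumberTheory.EllipticCurves.ModularForms Literature.NumberTheory.EllipticCurves.Rank1Residual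
  Literature.NumberTheory.EllipticCurves.Module
  Literature.NumberTheory.NumberFields Literature.NumberTheory.CubicFields
  Summit.BirchSwinnertonDyer.Rank1Residual Summit.BirchSwinnertonDyer.Rank1Residual.X1.MuLambda
  Summit.BirchSwinnertonDyer.Rank1Residual.X5 Summit.BirchSwinnertonDyer.Rank1Residual.X5.O1
  Summit.BirchSwinnertonDyer.Rank1Residual.X5.Instances Summit.BirchSwinnertonDyer.Rank1Residual.F1Sign2
  Summit.BirchSwinnertonDyer.BirchSwinnertonDyer.Theorems.Rank1ResidualX1Defs
  Summit.BirchSwinnertonDyer.BirchSwinnertonDyer.Theses.AlignedTransportAtTwo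
  Summit.BirchSwinnertonDyer.BirchSwinnertonDyer.Theorems.AlignedTransportAtTwoKilfordStratumShared
open Summit.BirchSwinnertonDyer.BirchSwinnertonDyer.Theorems.AlignedTransportAtTwoCubicKilfordPrimes (psi_gen_eq_zero)

/-! ## §0 The curve `⟨1, 1, 0, -122, -573⟩` of conductor `13971 = 13971` (rank 0, `L/Ω = 1`) — kernel-decided invariants and its cubic field -/

/-- `Δ = −13971`. [cite: SilvermanAEC2009, III.1] -/
theorem M13971_Δ : (⟨1, 1, 0, -122, -573⟩ : WeierstrassCurve ℤ).Δ = -13971 := by decide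

/-- `c₄ = 5881`. [cite: SilvermanAEC2009, III.1] -/
theorem M13971_c₄ : (⟨1, 1, 0, -122, -573⟩ : WeierstrassCurve ℤ).c₄ = 5881 := by decide

/-- `⟨1, 1, 0, -122, -573⟩` is an elliptic curve (`Δ = −13971 ≠ 0`). [cite: SilvermanAEC2009, III.1] -/
theorem isElliptic_n13971 : ((⟨1, 1, 0, -122, -573⟩ : WeierstrassCurve ℤ).baseChange ℚ).IsElliptic := by
  rw [WeierstrassCurve.isElliptic_iff, baseChange_int_Δ, M13971_Δ]; norm_num

/-- The model `⟨1, 1, 0, -122, -573⟩` is globally minimal (`gcd(Δ, c₄) = 1`). [cite: SilvermanAEC2009, VII.1 Remark 1.1] -/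
theorem isGloballyMinimal_n13971 : ((⟨1, 1, 0, -122, -573⟩ : WeierstrassCurve ℤ).baseChange ℚ).IsGloballyMinimal :=
  isGloballyMinimal_baseChange_int_of_gcd_eq_one 1 (1) 0 (-122) (-573) (by decide)

/-- `⟨1, 1, 0, -122, -573⟩ mod 2` is `[1, 1, 0, 0, 1]`. [folklore] -/
theorem M13971_mod_two : (⟨1, 1, 0, -122, -573⟩ : WeierstrassCurve ℤ).map (Int.castRingHom (ZMod 2)) = ⟨1, 1, 0, 0, 1⟩ := by
  ext <;> decide

/-- `#Ẽ(𝔽₂) = 2` for `⟨1, 1, 0, -122, -573⟩` (`a₂ = 3 − 2 = 1`, odd). [cite: SilvermanAEC2009, V.2] -/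
theorem M13971_card_two :
    Nat.card ((⟨1, 1, 0, -122, -573⟩ : WeierstrassCurve ℤ).map (Int.castRingHom (ZMod 2))).toAffine.Point = 2 := by
  rw [M13971_mod_two, natCard_point_eq_one_add_card _ (by decide)]; decide

/-- **`⟨1, 1, 0, -122, -573⟩` has good ORDINARY reduction at `2`** (`2 ∤ Δ`, `#Ẽ(𝔽₂) = 2`, `a₂` odd). [cite: SilvermanAEC2009, VII.5 Prop. 5.1 (a)] -/
theorem goodOrd_two_n13971 [((⟨1, 1, 0, -122, -573⟩ : WeierstrassCurve ℤ).baseChange ℚ).IsElliptic] [((⟨1, 1, 0, -122, -573⟩ : WeierstrassCurve ℤ).baseChange ℚ).IsGloballyMinimal] : GoodOrd ((⟨1, 1, 0, -122, -573⟩ : WeierstrassCurve ℤ).baseChange ℚ) 2 :=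
  Instances.goodOrd_two_baseChange_int_of_card_two _ (by rw [M13971_Δ]; decide) M13971_card_two

/-- The coefficients of `⟨1, 1, 0, -122, -573⟩ / ℚ` (unfolded). [cite: SilvermanAEC2009, III.1] -/
theorem c13971_eq : ((⟨1, 1, 0, -122, -573⟩ : WeierstrassCurve ℤ).baseChange ℚ) = ⟨1, 1, 0, -122, -573⟩ := by
  rw [baseChange_int_eq]; norm_num

/-- `b₂, b₄, b₆` of `⟨1, 1, 0, -122, -573⟩`: `5, -244, -2292`. [cite: SilvermanAEC2009, III.1] -/
theorem c13971_b : ((⟨1, 1, 0, -122, -573⟩ : WeierstrassCurve ℤ).baseChange ℚ).b₂ = ((5 : ℤ) : ℚ) ∧ ((⟨1, 1, 0, -122, -573⟩ : WeierstrassCurve ℤ).baseChange ℚ).b₄ = ((-244 : ℤ) : ℚ) ∧ ((⟨1, 1, 0, -122, -573⟩ : WeierstrassCurve ℤ).baseChange ℚ).b₆ = ((-2292 : ℤ) : ℚ) := by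
  rw [c13971_eq]; simp only [WeierstrassCurve.b₂, WeierstrassCurve.b₄, WeierstrassCurve.b₆]; norm_num

/-- **`E[2]` irreducible for `⟨1, 1, 0, -122, -573⟩`**: the monic `u`-cubic `u³ + 5u² − 1952u − 36672` has no root modulo `5`.
[cite: SilvermanAEC2009, III.2.3 (b)] -/
theorem irr_two_n13971 [((⟨1, 1, 0, -122, -573⟩ : WeierstrassCurve ℤ).baseChange ℚ).IsElliptic] : Irr ((⟨1, 1, 0, -122, -573⟩ : WeierstrassCurve ℤ).baseChange ℚ) 2 :=
  irr_two_of_forall_cubic_ne _ c13971_b.1 c13971_b.2.1 c13971_b.2.2 (ℓ := 5) (by decide)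

/-- No rational `2`-torsion abscissa on `⟨1, 1, 0, -122, -573⟩` (the route's `ht` binder). [cite: SilvermanAEC2009, III.2.3 (b)] -/
theorem not_hasRationalTwoTorsionX_n13971 [((⟨1, 1, 0, -122, -573⟩ : WeierstrassCurve ℤ).baseChange ℚ).IsElliptic] : ∀ x : ℚ, ¬ HasRationalTwoTorsionX ((⟨1, 1, 0, -122, -573⟩ : WeierstrassCurve ℤ).baseChange ℚ) x := by
  intro x hx
  exact (O1.irr_two_iff_not_exists_addOrderOf_eq_two _).mp irr_two_n13971 (exists_point_addOrderOf_eq_two hx)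

/-- `Δ_min = −13971`. [cite: SilvermanAEC2009, VII.1] -/
theorem minimalDiscriminantInt_n13971 [((⟨1, 1, 0, -122, -573⟩ : WeierstrassCurve ℤ).baseChange ℚ).IsGloballyMinimal] : ((⟨1, 1, 0, -122, -573⟩ : WeierstrassCurve ℤ).baseChange ℚ).minimalDiscriminantInt = -13971 := by
  rw [Instances.minimalDiscriminantInt_baseChange_int, M13971_Δ]

/-- `Δ_min = −13971 ≡ 5 (mod 8)`: OFF the Kilford stratum (`2 = 𝔭₁𝔭₂` in `ℚ(β)`). [cite: Serre1973, Ch. II §3.3 Thm. 4] -/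
theorem minimalDiscriminantInt_emod_eight_n13971 [((⟨1, 1, 0, -122, -573⟩ : WeierstrassCurve ℤ).baseChange ℚ).IsGloballyMinimal] : ((⟨1, 1, 0, -122, -573⟩ : WeierstrassCurve ℤ).baseChange ℚ).minimalDiscriminantInt % 8 = 5 := by
  rw [minimalDiscriminantInt_n13971]; decide

/-- **`⟨1, 1, 0, -122, -573⟩` is OFF the Kilford stratum.** [cite: Serre1973, Ch. II §3.3 Thm. 4] -/
theorem not_onKilfordStratumAtTwo_n13971 [((⟨1, 1, 0, -122, -573⟩ : WeierstrassCurve ℤ).baseChange ℚ).IsElliptic] [((⟨1, 1, 0, -122, -573⟩ : WeierstrassCurve ℤ).baseChange ℚ).IsGloballyMinimal] : ¬ OnKilfordStratumAtTwo ((⟨1, 1, 0, -122, -573⟩ : WeierstrassCurve ℤ).baseChange ℚ) :=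
  (not_onKilfordStratumAtTwo_iff_minimalDiscriminantInt_emod_eight_ne _ goodOrd_two_n13971).mpr
    (by rw [minimalDiscriminantInt_n13971]; decide)

/-- `Δ < 0` (`ℚ(β)` is a complex cubic field). [cite: SilvermanAEC2009, III.1] -/
theorem Δ_n13971_neg : ((⟨1, 1, 0, -122, -573⟩ : WeierstrassCurve ℤ).baseChange ℚ).Δ < 0 := by
  rw [baseChange_int_Δ, M13971_Δ]; norm_num

/-- **`θ := −5g² + (111/4)g + 841/2 = (6728 + 111u − 5u²)/16 ∈ ℚ(β)` is a root of `f = X³ + X² + 15X + 12`** (one `linear_combination` against `ψ_W(β) = 4β³ + 5β² + 2·(-244)β + -2292 = 0`;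
the multiplier is the exact quotient in `ℚ[β]`). [cite: LMFDB, number field 3.1.13971.1 (degree 3, discriminant −13971)] [cite: SilvermanAEC2009, III.1] -/
theorem aeval_theta_n13971 {β : AlgebraicClosure ℚ} (hβ : aeval β ((⟨1, 1, 0, -122, -573⟩ : WeierstrassCurve ℤ).baseChange ℚ).twoTorsionPolynomial.toPoly = 0) :
    aeval ((-5 : ↥(IntermediateField.adjoin ℚ ({β} : Set (AlgebraicClosure ℚ)))) * (AdjoinSimple.gen ℚ β : ↥(IntermediateField.adjoin ℚ ({β} : Set (AlgebraicClosure ℚ)))) ^ 2 + 111 / 4 * (AdjoinSimple.gen ℚ β : ↥(IntermediateField.adjoin ℚ ({β} : Set (AlgebraicClosure ℚ)))) + 841 / 2) (MonicCubic.poly (1) (15) (12)) = 0 := by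
  have hψ := psi_gen_eq_zero ((⟨1, 1, 0, -122, -573⟩ : WeierstrassCurve ℤ).baseChange ℚ) hβ
  rw [c13971_b.1, c13971_b.2.1, c13971_b.2.2] at hψ
  set g : ↥(IntermediateField.adjoin ℚ ({β} : Set (AlgebraicClosure ℚ))) := AdjoinSimple.gen ℚ β with hg
  simp only [MonicCubic.poly, map_add, map_mul, map_pow, aeval_X, eq_intCast, map_intCast]
  push_cast at hψ ⊢
  linear_combination ((-1040643 / 32 : ↥(IntermediateField.adjoin ℚ ({β} : Set (AlgebraicClosure ℚ)))) * g ^ 0 + (31435 / 64 : ↥(IntermediateField.adjoin ℚ ({β} : Set (AlgebraicClosure ℚ)))) * g ^ 1 + (4475 / 8 : ↥(IntermediateField.adjoin ℚ ({β} : Set (AlgebraicClosure ℚ)))) * g ^ 2 + (-125 / 4 : ↥(IntermediateField.adjoin ℚ ({β} : Set (AlgebraicClosure ℚ)))) * g ^ 3) * hψ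

/-- `[ℚ(β) : ℚ] = 3`. [cite: SilvermanAEC2009, III.2.3 (b)] -/
theorem finrank_cubicField_n13971 {β : AlgebraicClosure ℚ} (hβ : aeval β ((⟨1, 1, 0, -122, -573⟩ : WeierstrassCurve ℤ).baseChange ℚ).twoTorsionPolynomial.toPoly = 0) :
    finrank ℚ ↥(IntermediateField.adjoin ℚ ({β} : Set (AlgebraicClosure ℚ))) = 3 := by
  haveI := isElliptic_n13971
  exact AddKatoTwo.finrank_adjoin_root_twoTorsionPolynomial_eq_three _
    (AlignedTransportAtTwoSeed.irr_two_of_forall_not_hasRationalTwoTorsionX _ not_hasRationalTwoTorsionX_n13971) hβ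

/-- **`d_{ℚ(β)} = −13971`**. [cite: LMFDB, number field 3.1.13971.1 (discriminant −13971)] -/
theorem discr_cubicField_n13971 {β : AlgebraicClosure ℚ} (hβ : aeval β ((⟨1, 1, 0, -122, -573⟩ : WeierstrassCurve ℤ).baseChange ℚ).twoTorsionPolynomial.toPoly = 0) :
    (haveI : FiniteDimensional ℚ ↥(IntermediateField.adjoin ℚ ({β} : Set (AlgebraicClosure ℚ))) := IntermediateField.adjoin.finiteDimensional ((AlgebraicClosure.isAlgebraic ℚ).isAlgebraic β).isIntegral;
      haveI : NumberField ↥(IntermediateField.adjoin ℚ ({β} : Set (AlgebraicClosure ℚ))) := NumberField.mk;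
      NumberField.discr ↥(IntermediateField.adjoin ℚ ({β} : Set (AlgebraicClosure ℚ))) = -13971) := by
  haveI : FiniteDimensional ℚ ↥(IntermediateField.adjoin ℚ ({β} : Set (AlgebraicClosure ℚ))) := IntermediateField.adjoin.finiteDimensional ((AlgebraicClosure.isAlgebraic ℚ).isAlgebraic β).isIntegral
  haveI : NumberField ↥(IntermediateField.adjoin ℚ ({β} : Set (AlgebraicClosure ℚ))) := NumberField.mk
  exact CubicDisc13971.discr_eq (finrank_cubicField_n13971 hβ) (aeval_theta_n13971 hβ)

/-- ★ **`h(ℚ(β)) = 1`** (`ℚ(β)` = the cubic field of discriminant `−13971`, this seat's `CubicDisc13971.classNumber_eq_one`). [cite: LMFDB, number field 3.1.13971.1 (class number 1)] -/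
theorem classNumber_cubicField_n13971_eq_one {β : AlgebraicClosure ℚ} (hβ : aeval β ((⟨1, 1, 0, -122, -573⟩ : WeierstrassCurve ℤ).baseChange ℚ).twoTorsionPolynomial.toPoly = 0) :
    (haveI : FiniteDimensional ℚ ↥(IntermediateField.adjoin ℚ ({β} : Set (AlgebraicClosure ℚ))) := IntermediateField.adjoin.finiteDimensional ((AlgebraicClosure.isAlgebraic ℚ).isAlgebraic β).isIntegral;
      haveI : NumberField ↥(IntermediateField.adjoin ℚ ({β} : Set (AlgebraicClosure ℚ))) := NumberField.mk;
      classNumber ↥(IntermediateField.adjoin ℚ ({β} : Set (AlgebraicClosure ℚ))) = 1) := by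
  haveI : FiniteDimensional ℚ ↥(IntermediateField.adjoin ℚ ({β} : Set (AlgebraicClosure ℚ))) := IntermediateField.adjoin.finiteDimensional ((AlgebraicClosure.isAlgebraic ℚ).isAlgebraic β).isIntegral
  haveI : NumberField ↥(IntermediateField.adjoin ℚ ({β} : Set (AlgebraicClosure ℚ))) := NumberField.mk
  exact CubicDisc13971.classNumber_eq_one (finrank_cubicField_n13971 hβ) (aeval_theta_n13971 hβ)

/-- ★ **`2 ∤ h(ℚ(β))`** (the doors' datum verbatim). [cite: LMFDB, number field 3.1.13971.1 (class number 1)] -/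
theorem not_two_dvd_classNumber_cubicField_n13971 {β : AlgebraicClosure ℚ} (hβ : aeval β ((⟨1, 1, 0, -122, -573⟩ : WeierstrassCurve ℤ).baseChange ℚ).twoTorsionPolynomial.toPoly = 0) :
    (haveI : FiniteDimensional ℚ ↥(IntermediateField.adjoin ℚ ({β} : Set (AlgebraicClosure ℚ))) := IntermediateField.adjoin.finiteDimensional ((AlgebraicClosure.isAlgebraic ℚ).isAlgebraic β).isIntegral;
      haveI : NumberField ↥(IntermediateField.adjoin ℚ ({β} : Set (AlgebraicClosure ℚ))) := NumberField.mk;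
      ¬ 2 ∣ classNumber ↥(IntermediateField.adjoin ℚ ({β} : Set (AlgebraicClosure ℚ)))) := by
  haveI : FiniteDimensional ℚ ↥(IntermediateField.adjoin ℚ ({β} : Set (AlgebraicClosure ℚ))) := IntermediateField.adjoin.finiteDimensional ((AlgebraicClosure.isAlgebraic ℚ).isAlgebraic β).isIntegral
  haveI : NumberField ↥(IntermediateField.adjoin ℚ ({β} : Set (AlgebraicClosure ℚ))) := NumberField.mk
  exact CubicDisc13971.not_two_dvd_classNumber (finrank_cubicField_n13971 hβ) (aeval_theta_n13971 hβ)


end Summit.BirchSwinnertonDyer.BirchSwinnertonDyer.Theorems.AlignedTransportAtTwoCubicDoorsDeadSubcellClassNumberJ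

end
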